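import Mathlib
import Summits.NavierStokesRegularity.NavierStokesRegularity.Theorems.TypeIIInviscidRelaxationCoreExclusionShadowingFlatCore
import HarnessLib

/-!
# Cruxes `ColumnarCoreExclusion` (stmt-1966) / `MonopoleCoreExclusion` (stmt-1965): at SMALL levels `K ≤ 2A` the
# single-level shadowing statement `P_A(K)` is regularity-complete (the comparison flow `v ≡ 0` is admissible)

`--supports stmt-NavierStokesRegularity-1966` (helper file; theorems only, no definitions, no `sorry`; route-independent
imports; the axisymmetric half serves stmt-1965).

After `…CoreExclusionShadowingLevelCollapse` (p840666) and `…{Columnar,Monopole}CoreExclusionExplicitBudget`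
(p840687 / p840704 / p840714 / p840715) the typed research residue of both comparison-flow lines is ONE level:
`∃ K ≥ 1, P_3(K)` (columnar) / `∃ K ≥ 1, P₂(K)` (axisymmetric, under `AX`), where `P_A(K)` = «classical Leray–Hopf
solution on `[0,T)`, rapidly decaying datum, `‖u(t)‖ ≤ V`, near-maximum within `L` of `x₀`, `Kν ≤ LV`,
`(T - t)V ≤ KL`, a bounded classical comparison flow of the class `A·V/K`-close to `u(t)` on the core ball ⟹ `u`
bounded on `[t,T) ×` inner ball».  This file locates WHERE in `K` that residue can possibly be witnessed:

* `exists_budget_of_le_twoA` — if `K ≤ 2A`, every slice with an attained positive maximum `S` admits a speed bound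
  `V` (`= max S (KS/A)`) with `‖u(t)‖ ≤ V`, `‖u(t)‖ ≤ A·V/K` EVERYWHERE and a half-maximum point `V ≤ 2‖u(t,x₁)‖`:
  the ZERO flow is then an admissible comparison flow (it is columnar along every axis and axisymmetric about every
  axis), on any ball.
* `localBound_of_columnarLevelShadowing_of_smallSlice`, `localBound_of_axisymLevelShadowing_of_smallSlice` — hence
  `P_A(K)` applied with `v ≡ 0` and a core length `L ≥ max (Kν/V, (T-t)V/K, dist x₁ x₀, 8r/(3K))` (resp. `2r/K`)
  bounds `u` on `[t,T) × B(x₀, r)` for EVERY centre `x₀` and radius `r`.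
* `localBound_of_columnarLevelShadowing_le_twoA`, `localBound_of_axisymLevelShadowing_le_twoA` — for `0 < K ≤ 2A`,
  `P_A(K)` implies: every classical Leray–Hopf solution on `[0,T)` (rapidly decaying datum) whose slice at some
  `t ∈ (0,T)` is bounded with an attained nonzero maximum is locally bounded up to `T` everywhere — i.e. `P_A(K)` at
  such a level is a NO-BLOW-UP theorem for the whole class, with no columnar / axisymmetric content left.  For the
  explicit residues: `P_3(K)` is regularity-complete for `K ≤ 6`, `P₂(K)` for `K ≤ 4`; by level monotonicity
  (`columnarShadowing_level_mono`) a witness level can always be raised, so the research content of both lines sits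
  exactly at levels `K > 2A`, where `A·V/K < V/2 ≤ ‖u(t,x₁)‖` forces a NON-TRIVIAL comparison flow near the core.

Honest framing.  A threshold remark in kernel form (which part of the one-level residue is NS-regularity itself); no
stub is closed by name; nothing about Navier–Stokes regularity is claimed; rung 0.
-/

open Set Metric
open Literature.Analysis Literature.Analysis.FluidPDE

namespace Summit.NavierStokesRegularity.NavierStokesRegularity.Theorems

-- the problem directory repeats the summit name (`NavierStokesRegularity/NavierStokesRegularity`)
set_option linter.dupNamespace false

namespace CoreExclusionShadowing

/-- **Budget at small level.**  If `0 < K ≤ 2A` and the slice `w` is bounded by an ATTAINED positive value `S`, then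
`V := max S (K·S/A)` is a speed bound with `‖w‖ ≤ A·V/K` everywhere and a half-maximum point (`V ≤ 2S ≤ 2‖w x₁‖`).
[folklore] -/
theorem exists_budget_of_le_twoA {A K S : ℝ} {w : EuclideanSpace ℝ (Fin 3) → EuclideanSpace ℝ (Fin 3)}
    (hA : 0 < A) (hK : 0 < K) (hKA : K ≤ 2 * A) (hS : 0 < S) (hbd : ∀ x, ‖w x‖ ≤ S)
    (hmax : ∃ x₁, S ≤ ‖w x₁‖) :
    ∃ V : ℝ, 0 < V ∧ (∀ x, ‖w x‖ ≤ V) ∧ (∀ x, ‖w x‖ ≤ A * V / K) ∧ ∃ x₁, V ≤ 2 * ‖w x₁‖ := by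
  obtain ⟨x₁, hx₁⟩ := hmax
  refine ⟨max S (K * S / A), lt_max_of_lt_left hS, fun x => (hbd x).trans (le_max_left _ _), fun x => ?_,
    x₁, ?_⟩
  · calc ‖w x‖ ≤ S := hbd x
      _ = A * (K * S / A) / K := by field_simp
      _ ≤ A * max S (K * S / A) / K := by
        apply div_le_div_of_nonneg_right _ hK.le
        exact mul_le_mul_of_nonneg_left (le_max_right _ _) hA.le
  · have h1 : K * S / A ≤ 2 * S := by
      rw [div_le_iff₀ hA]
      calc K * S ≤ 2 * A * S := mul_le_mul_of_nonneg_right hKA hS.le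
        _ = 2 * S * A := by ring
    calc max S (K * S / A) ≤ 2 * S := max_le (by linarith) h1
      _ ≤ 2 * ‖w x₁‖ := by linarith

/-! ## Columnar class -/

/-- **Small slice ⟹ local bound everywhere, columnar class.**  If the single-level columnar shadowing statement
`P_A(K)` holds and the slice `u(t)` of a classical Leray–Hopf solution (rapidly decaying datum) admits a speed bound
`V > 0` with `‖u(t)‖ ≤ A·V/K` everywhere and a half-maximum point, then `u` is bounded on `[t,T) × B(x₀, r)` for
every `x₀, r`: apply `P_A(K)` with the zero comparison flow and a core length
`L = max (max (Kν/V) ((T-t)V/K)) (max (dist x₁ x₀) (8r/(3K)))`. [folklore] -/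
theorem localBound_of_columnarLevelShadowing_of_smallSlice {A K : ℝ} (hK : 0 < K)
    (hP : ∀ (ν T t : ℝ) (u : ℝ → EuclideanSpace ℝ (Fin 3) → EuclideanSpace ℝ (Fin 3))
        (p : ℝ → EuclideanSpace ℝ (Fin 3) → ℝ),
        0 < ν → 0 < T → IsClassicalNSSolutionOn (Ico 0 T) ν 0 u p → IsLerayHopfOn T ν 0 (u 0) u →
        HasRapidSpatialDecay (u 0) → 0 < t → t < T →
        ∀ (x₀ : EuclideanSpace ℝ (Fin 3)) (L V : ℝ)
          (Q : EuclideanSpace ℝ (Fin 3) ≃ₗᵢ[ℝ] EuclideanSpace ℝ (Fin 3)),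
          0 < L → 0 < V → (∀ x, ‖u t x‖ ≤ V) →
          (∃ x₁, dist x₁ x₀ ≤ L ∧ V ≤ 2 * ‖u t x₁‖) → K * ν ≤ L * V → (T - t) * V ≤ K * L →
          ∀ (v : ℝ → EuclideanSpace ℝ (Fin 3) → EuclideanSpace ℝ (Fin 3))
            (q : ℝ → EuclideanSpace ℝ (Fin 3) → ℝ) (Mv : ℝ),
            IsClassicalNSSolutionOn (Icc t T) ν 0 v q →
            (∀ s ∈ Icc t T, ∀ (x : EuclideanSpace ℝ (Fin 3)) (τ : ℝ), v s (x + τ • Q eZ) = v s x) →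
            (∀ s ∈ Icc t T, ∀ x, ‖v s x‖ ≤ Mv) →
            (∀ x ∈ ball x₀ (K * L / 2), ‖u t x - v t x‖ ≤ A * V / K) →
            ∃ M : ℝ, ∀ s ∈ Ico t T, ∀ x ∈ ball x₀ (3 * K * L / 8), ‖u s x‖ ≤ M) :
    ∀ (ν T t : ℝ) (u : ℝ → EuclideanSpace ℝ (Fin 3) → EuclideanSpace ℝ (Fin 3))
      (p : ℝ → EuclideanSpace ℝ (Fin 3) → ℝ),
      0 < ν → 0 < T → IsClassicalNSSolutionOn (Ico 0 T) ν 0 u p → IsLerayHopfOn T ν 0 (u 0) u →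
      HasRapidSpatialDecay (u 0) → 0 < t → t < T →
      ∀ V : ℝ, 0 < V → (∀ x, ‖u t x‖ ≤ V) → (∀ x, ‖u t x‖ ≤ A * V / K) → (∃ x₁, V ≤ 2 * ‖u t x₁‖) →
      ∀ (x₀ : EuclideanSpace ℝ (Fin 3)) (r : ℝ),
        ∃ M : ℝ, ∀ s ∈ Ico t T, ∀ x ∈ ball x₀ r, ‖u s x‖ ≤ M := by
  intro ν T t u p hν hT hcl hLH hdec ht htT V hV hbd hsmall hhalf x₀ r
  obtain ⟨x₁, hx₁⟩ := hhalf
  set L : ℝ := max (max (K * ν / V) ((T - t) * V / K)) (max (dist x₁ x₀) (8 * r / (3 * K))) with hL_def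
  have hL1 : K * ν / V ≤ L := (le_max_left _ _).trans (le_max_left _ _)
  have hL2 : (T - t) * V / K ≤ L := (le_max_right _ _).trans (le_max_left _ _)
  have hL3 : dist x₁ x₀ ≤ L := (le_max_left _ _).trans (le_max_right _ _)
  have hL4 : 8 * r / (3 * K) ≤ L := (le_max_right _ _).trans (le_max_right _ _)
  have hLpos : 0 < L := lt_of_lt_of_le (by positivity) hL1
  have hRe : K * ν ≤ L * V := by
    have := (div_le_iff₀ hV).1 hL1
    linarith
  have hlate : (T - t) * V ≤ K * L := by
    have := (div_le_iff₀ hK).1 hL2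
    linarith
  have hr : r ≤ 3 * K * L / 8 := by
    have := (div_le_iff₀ (by positivity : (0 : ℝ) < 3 * K)).1 hL4
    linarith
  obtain ⟨M, hM⟩ := hP ν T t u p hν hT hcl hLH hdec ht htT x₀ L V (LinearIsometryEquiv.refl ℝ _) hLpos hV
    hbd ⟨x₁, hL3, hx₁⟩ hRe hlate (fun _ _ => 0) (fun _ _ => 0) 0
    (isClassicalNSSolutionOn_constVec (Icc t T) ν 0) (fun _ _ _ _ => rfl) (fun _ _ _ => by simp)
    (fun x _ => by simpa using hsmall x)
  exact ⟨M, fun s hs x hx => hM s hs x (ball_subset_ball hr hx)⟩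

/-- **`P_A(K)` is regularity-complete at levels `K ≤ 2A`, columnar class.**  If `0 < K ≤ 2A` and the single-level
columnar shadowing statement `P_A(K)` holds, then every classical Leray–Hopf solution on `[0,T)` (rapidly decaying
datum) whose slice at some `t ∈ (0,T)` is bounded by an attained positive value `S` is bounded on `[t,T) × B(x₀, r)`
for every `x₀, r` — no columnar content is left.  In particular the explicit residue `∃ K ≥ 1, P_3(K)` of line
`columnar_comparison_flow` (p840687) is NS-regularity itself when witnessed at `K ≤ 6`. [folklore] -/
theorem localBound_of_columnarLevelShadowing_le_twoA {A K : ℝ} (hA : 0 < A) (hK : 0 < K) (hKA : K ≤ 2 * A)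
    (hP : ∀ (ν T t : ℝ) (u : ℝ → EuclideanSpace ℝ (Fin 3) → EuclideanSpace ℝ (Fin 3))
        (p : ℝ → EuclideanSpace ℝ (Fin 3) → ℝ),
        0 < ν → 0 < T → IsClassicalNSSolutionOn (Ico 0 T) ν 0 u p → IsLerayHopfOn T ν 0 (u 0) u →
        HasRapidSpatialDecay (u 0) → 0 < t → t < T →
        ∀ (x₀ : EuclideanSpace ℝ (Fin 3)) (L V : ℝ)
          (Q : EuclideanSpace ℝ (Fin 3) ≃ₗᵢ[ℝ] EuclideanSpace ℝ (Fin 3)),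
          0 < L → 0 < V → (∀ x, ‖u t x‖ ≤ V) →
          (∃ x₁, dist x₁ x₀ ≤ L ∧ V ≤ 2 * ‖u t x₁‖) → K * ν ≤ L * V → (T - t) * V ≤ K * L →
          ∀ (v : ℝ → EuclideanSpace ℝ (Fin 3) → EuclideanSpace ℝ (Fin 3))
            (q : ℝ → EuclideanSpace ℝ (Fin 3) → ℝ) (Mv : ℝ),
            IsClassicalNSSolutionOn (Icc t T) ν 0 v q →
            (∀ s ∈ Icc t T, ∀ (x : EuclideanSpace ℝ (Fin 3)) (τ : ℝ), v s (x + τ • Q eZ) = v s x) →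
            (∀ s ∈ Icc t T, ∀ x, ‖v s x‖ ≤ Mv) →
            (∀ x ∈ ball x₀ (K * L / 2), ‖u t x - v t x‖ ≤ A * V / K) →
            ∃ M : ℝ, ∀ s ∈ Ico t T, ∀ x ∈ ball x₀ (3 * K * L / 8), ‖u s x‖ ≤ M) :
    ∀ (ν T t : ℝ) (u : ℝ → EuclideanSpace ℝ (Fin 3) → EuclideanSpace ℝ (Fin 3))
      (p : ℝ → EuclideanSpace ℝ (Fin 3) → ℝ),
      0 < ν → 0 < T → IsClassicalNSSolutionOn (Ico 0 T) ν 0 u p → IsLerayHopfOn T ν 0 (u 0) u →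
      HasRapidSpatialDecay (u 0) → 0 < t → t < T →
      ∀ S : ℝ, 0 < S → (∀ x, ‖u t x‖ ≤ S) → (∃ x₁, S ≤ ‖u t x₁‖) →
      ∀ (x₀ : EuclideanSpace ℝ (Fin 3)) (r : ℝ),
        ∃ M : ℝ, ∀ s ∈ Ico t T, ∀ x ∈ ball x₀ r, ‖u s x‖ ≤ M := by
  intro ν T t u p hν hT hcl hLH hdec ht htT S hS hbd hmax x₀ r
  obtain ⟨V, hV, hbdV, hsmall, hhalf⟩ := exists_budget_of_le_twoA hA hK hKA hS hbd hmax
  exact localBound_of_columnarLevelShadowing_of_smallSlice hK hP ν T t u p hν hT hcl hLH hdec ht htT V hV hbdV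
    hsmall hhalf x₀ r

/-! ## Axisymmetric class -/

/-- **Small slice ⟹ local bound everywhere, axisymmetric class.**  As
`localBound_of_columnarLevelShadowing_of_smallSlice` for the single-level axisymmetric statement `P_A(K)` (closeness
on `B(x₀, KL)`, conclusion on `B(x₀, KL/2)`): the zero flow is axisymmetric about every axis; core length
`L = max (max (Kν/V) ((T-t)V/K)) (max (dist x₁ x₀) (2r/K))`. [folklore] -/
theorem localBound_of_axisymLevelShadowing_of_smallSlice {A K : ℝ} (hK : 0 < K)
    (hP : ∀ (ν T t : ℝ) (u : ℝ → EuclideanSpace ℝ (Fin 3) → EuclideanSpace ℝ (Fin 3))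
        (p : ℝ → EuclideanSpace ℝ (Fin 3) → ℝ),
        0 < ν → 0 < T → IsClassicalNSSolutionOn (Ico 0 T) ν 0 u p → IsLerayHopfOn T ν 0 (u 0) u →
        HasRapidSpatialDecay (u 0) → 0 < t → t < T →
        ∀ (x₀ : EuclideanSpace ℝ (Fin 3)) (L V : ℝ)
          (Q : EuclideanSpace ℝ (Fin 3) ≃ₗᵢ[ℝ] EuclideanSpace ℝ (Fin 3)),
          0 < L → 0 < V → (∀ x, ‖u t x‖ ≤ V) →
          (∃ x₁, dist x₁ x₀ ≤ L ∧ V ≤ 2 * ‖u t x₁‖) → K * ν ≤ L * V → (T - t) * V ≤ K * L →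
          ∀ (v : ℝ → EuclideanSpace ℝ (Fin 3) → EuclideanSpace ℝ (Fin 3))
            (q : ℝ → EuclideanSpace ℝ (Fin 3) → ℝ) (Mv : ℝ),
            IsClassicalNSSolutionOn (Icc t T) ν 0 v q →
            (∀ s ∈ Icc t T, IsAxisymmetric (fun y : EuclideanSpace ℝ (Fin 3) => Q.symm (v s (x₀ + Q y)))) →
            (∀ s ∈ Icc t T, ∀ x, ‖v s x‖ ≤ Mv) →
            (∀ x ∈ ball x₀ (K * L), ‖u t x - v t x‖ ≤ A * V / K) →
            ∃ M : ℝ, ∀ s ∈ Ico t T, ∀ x ∈ ball x₀ (K * L / 2), ‖u s x‖ ≤ M) :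
    ∀ (ν T t : ℝ) (u : ℝ → EuclideanSpace ℝ (Fin 3) → EuclideanSpace ℝ (Fin 3))
      (p : ℝ → EuclideanSpace ℝ (Fin 3) → ℝ),
      0 < ν → 0 < T → IsClassicalNSSolutionOn (Ico 0 T) ν 0 u p → IsLerayHopfOn T ν 0 (u 0) u →
      HasRapidSpatialDecay (u 0) → 0 < t → t < T →
      ∀ V : ℝ, 0 < V → (∀ x, ‖u t x‖ ≤ V) → (∀ x, ‖u t x‖ ≤ A * V / K) → (∃ x₁, V ≤ 2 * ‖u t x₁‖) →
      ∀ (x₀ : EuclideanSpace ℝ (Fin 3)) (r : ℝ),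
        ∃ M : ℝ, ∀ s ∈ Ico t T, ∀ x ∈ ball x₀ r, ‖u s x‖ ≤ M := by
  intro ν T t u p hν hT hcl hLH hdec ht htT V hV hbd hsmall hhalf x₀ r
  obtain ⟨x₁, hx₁⟩ := hhalf
  set L : ℝ := max (max (K * ν / V) ((T - t) * V / K)) (max (dist x₁ x₀) (2 * r / K)) with hL_def
  have hL1 : K * ν / V ≤ L := (le_max_left _ _).trans (le_max_left _ _)
  have hL2 : (T - t) * V / K ≤ L := (le_max_right _ _).trans (le_max_left _ _)
  have hL3 : dist x₁ x₀ ≤ L := (le_max_left _ _).trans (le_max_right _ _)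
  have hL4 : 2 * r / K ≤ L := (le_max_right _ _).trans (le_max_right _ _)
  have hLpos : 0 < L := lt_of_lt_of_le (by positivity) hL1
  have hRe : K * ν ≤ L * V := by
    have := (div_le_iff₀ hV).1 hL1
    linarith
  have hlate : (T - t) * V ≤ K * L := by
    have := (div_le_iff₀ hK).1 hL2
    linarith
  have hr : r ≤ K * L / 2 := by
    have := (div_le_iff₀ hK).1 hL4
    linarith
  have hax0 : IsAxisymmetric (fun _ : EuclideanSpace ℝ (Fin 3) => (0 : EuclideanSpace ℝ (Fin 3))) := by
    simpa using isAxisymmetric_const_smul_eZ 0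
  obtain ⟨M, hM⟩ := hP ν T t u p hν hT hcl hLH hdec ht htT x₀ L V (LinearIsometryEquiv.refl ℝ _) hLpos hV
    hbd ⟨x₁, hL3, hx₁⟩ hRe hlate (fun _ _ => 0) (fun _ _ => 0) 0
    (isClassicalNSSolutionOn_constVec (Icc t T) ν 0) (fun _ _ => by simpa using hax0) (fun _ _ _ => by simp)
    (fun x _ => by simpa using hsmall x)
  exact ⟨M, fun s hs x hx => hM s hs x (ball_subset_ball hr hx)⟩

/-- **`P_A(K)` is regularity-complete at levels `K ≤ 2A`, axisymmetric class.**  If `0 < K ≤ 2A` and the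
single-level axisymmetric shadowing statement `P_A(K)` holds, then every classical Leray–Hopf solution on `[0,T)`
(rapidly decaying datum) whose slice at some `t ∈ (0,T)` is bounded by an attained positive value is bounded on
`[t,T) × B(x₀, r)` for every `x₀, r`.  In particular the explicit residue `∃ K ≥ 1, P₂(K)` of line
`axisymmetric_comparison_flow` (p840704) is NS-regularity itself when witnessed at `K ≤ 4`. [folklore] -/
theorem localBound_of_axisymLevelShadowing_le_twoA {A K : ℝ} (hA : 0 < A) (hK : 0 < K) (hKA : K ≤ 2 * A)
    (hP : ∀ (ν T t : ℝ) (u : ℝ → EuclideanSpace ℝ (Fin 3) → EuclideanSpace ℝ (Fin 3))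
        (p : ℝ → EuclideanSpace ℝ (Fin 3) → ℝ),
        0 < ν → 0 < T → IsClassicalNSSolutionOn (Ico 0 T) ν 0 u p → IsLerayHopfOn T ν 0 (u 0) u →
        HasRapidSpatialDecay (u 0) → 0 < t → t < T →
        ∀ (x₀ : EuclideanSpace ℝ (Fin 3)) (L V : ℝ)
          (Q : EuclideanSpace ℝ (Fin 3) ≃ₗᵢ[ℝ] EuclideanSpace ℝ (Fin 3)),
          0 < L → 0 < V → (∀ x, ‖u t x‖ ≤ V) →
          (∃ x₁, dist x₁ x₀ ≤ L ∧ V ≤ 2 * ‖u t x₁‖) → K * ν ≤ L * V → (T - t) * V ≤ K * L →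
          ∀ (v : ℝ → EuclideanSpace ℝ (Fin 3) → EuclideanSpace ℝ (Fin 3))
            (q : ℝ → EuclideanSpace ℝ (Fin 3) → ℝ) (Mv : ℝ),
            IsClassicalNSSolutionOn (Icc t T) ν 0 v q →
            (∀ s ∈ Icc t T, IsAxisymmetric (fun y : EuclideanSpace ℝ (Fin 3) => Q.symm (v s (x₀ + Q y)))) →
            (∀ s ∈ Icc t T, ∀ x, ‖v s x‖ ≤ Mv) →
            (∀ x ∈ ball x₀ (K * L), ‖u t x - v t x‖ ≤ A * V / K) →
            ∃ M : ℝ, ∀ s ∈ Ico t T, ∀ x ∈ ball x₀ (K * L / 2), ‖u s x‖ ≤ M) :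
    ∀ (ν T t : ℝ) (u : ℝ → EuclideanSpace ℝ (Fin 3) → EuclideanSpace ℝ (Fin 3))
      (p : ℝ → EuclideanSpace ℝ (Fin 3) → ℝ),
      0 < ν → 0 < T → IsClassicalNSSolutionOn (Ico 0 T) ν 0 u p → IsLerayHopfOn T ν 0 (u 0) u →
      HasRapidSpatialDecay (u 0) → 0 < t → t < T →
      ∀ S : ℝ, 0 < S → (∀ x, ‖u t x‖ ≤ S) → (∃ x₁, S ≤ ‖u t x₁‖) →
      ∀ (x₀ : EuclideanSpace ℝ (Fin 3)) (r : ℝ),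
        ∃ M : ℝ, ∀ s ∈ Ico t T, ∀ x ∈ ball x₀ r, ‖u s x‖ ≤ M := by
  intro ν T t u p hν hT hcl hLH hdec ht htT S hS hbd hmax x₀ r
  obtain ⟨V, hV, hbdV, hsmall, hhalf⟩ := exists_budget_of_le_twoA hA hK hKA hS hbd hmax
  exact localBound_of_axisymLevelShadowing_of_smallSlice hK hP ν T t u p hν hT hcl hLH hdec ht htT V hV hbdV
    hsmall hhalf x₀ r

end CoreExclusionShadowing

end Summit.NavierStokesRegularity.NavierStokesRegularity.Theorems
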